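import Summits.QuantumFields.YangMills.Theses.SwapVirialDeficit
import HarnessLib

/-!
# Route `SwapVirialDeficit` (YangMills): the glue item `SwapMeanActionGapGlue` (stmt-QuantumFields-24198) holds BY NAME

`SwapMeanActionGapGlue := ToronSoftnessSharp → SwapGluedStiffness → SwapMeanActionGap` — the one-line subtraction
of the two SHARP mean-action rows of LINE g14-B (planner ym-idea-4 g14, P1 «RELATIVE GAP» re-hang): from
`SwapGluedStiffness` take `(a₁, c, β₁, L₁)`; apply `ToronSoftnessSharp` with `ε := c/2` to get `(a₂, β₂, L₂)`; on the
common window `a := min a₁ a₂`, `β₀ := max (max β₁ β₂) 1`, `L₀ := max L₁ L₂` (so that `L ≤ β^a` gives `L ≤ β^{a₁}` and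
`L ≤ β^{a₂}` because `β ≥ 1`) subtract:
`β(log Z^S)′ − β(log Z)′ ≤ (12βL⁴ − 9L⁴ + 3/2 − c) − (12βL⁴ − 9L⁴ + 3/2 − c/2) = −c/2`.

HONEST FRAMING: bookkeeping; the sharp cruxes `ToronSoftnessSharp` (stmt-QuantumFields-24196) and `SwapGluedStiffness`
(stmt-QuantumFields-24197) are OPEN, so `SwapMeanActionGap` (stmt-QuantumFields-24194) is NOT proved here; the line is
DRAFT-by-design; no summit conjunct is touched; the Yang–Mills mass gap is NOT proved.  No `sorry`, no new axiom, no
new definition.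
References: [cite: TomboulisYaffe1985]; [cite: tHooft1979].
-/

set_option autoImplicit false

namespace Summit.QuantumFields.YangMills.Theorems.SwapVirialDeficit

/-- **`SwapMeanActionGapGlue` holds** (item stmt-QuantumFields-24198 of route `SwapVirialDeficit`, BY NAME):
`ToronSoftnessSharp → SwapGluedStiffness → SwapMeanActionGap`, by subtracting the periodic sharp lower row at
`ε := c/2` from the swap-glued sharp upper row on the common Laplace window.  [cite: TomboulisYaffe1985] -/
theorem swapMeanActionGapGlue_proof :
    Summit.QuantumFields.YangMills.Theses.SwapVirialDeficit.SwapMeanActionGapGlue := by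
  intro hT hS
  obtain ⟨a₁, ha₁, c, hc, β₁, L₁, hS⟩ := hS
  obtain ⟨a₂, ha₂, β₂, L₂, hT⟩ := hT (c / 2) (by linarith)
  refine ⟨min a₁ a₂, lt_min ha₁ ha₂, c / 2, by linarith, max (max β₁ β₂) 1, max L₁ L₂, ?_⟩
  intro β hβ L _ hL hLa
  have hβ1 : (1 : ℝ) ≤ β := le_trans (le_max_right _ _) hβ
  have hβ₁ : β₁ ≤ β := le_trans (le_trans (le_max_left _ _) (le_max_left _ _)) hβ
  have hβ₂ : β₂ ≤ β := le_trans (le_trans (le_max_right _ _) (le_max_left _ _)) hβ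
  have hL₁ : L₁ ≤ L := le_trans (le_max_left _ _) hL
  have hL₂ : L₂ ≤ L := le_trans (le_max_right _ _) hL
  have hLa₁ : (L : ℝ) ≤ β ^ a₁ :=
    le_trans hLa (Real.rpow_le_rpow_of_exponent_le hβ1 (min_le_left _ _))
  have hLa₂ : (L : ℝ) ≤ β ^ a₂ :=
    le_trans hLa (Real.rpow_le_rpow_of_exponent_le hβ1 (min_le_right _ _))
  have h₁ := hS β hβ₁ L hL₁ hLa₁
  have h₂ := hT β hβ₂ L hL₂ hLa₂
  linarith

end Summit.QuantumFields.YangMills.Theorems.SwapVirialDeficit
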